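import Summits.MatrixMultiplication.OmegaCensus.STPPVosperCoverStageZ

/-!
# ω-census (abelian STPP census): the exact-cover search with PRECOMPUTED candidate lists (kernel evaluation aid)

HONEST FRAMING (pub-omega census; verbatim): lottery ticket; floor = certified bounds/negative ranges.
Census STRUCTURE (seat pub-omega-stpp-1 gen 31, 2026-08-28), family (b2).  `existsCoverZ` (`STPPVosperCoverStageZ.lean`) recomputes the candidate
difference data `blockDiffsZ` of the later blocks for every candidate of the earlier ones, which makes a two-block search too slow for one
`decide +kernel`.  `existsCoverPre` is the same backtracking over candidate lists given as an ARGUMENT (so the kernel evaluates each list once), and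
`existsCoverPre_map_eq` says it equals `existsCoverZ` when fed `blocks.map blockDiffsZ`.  Pure bookkeeping; nothing here is progress on `ω`.
-/

namespace Summit.MatrixMultiplication.OmegaCensus.CubeNB

/-- Backtracking exact-cover search over PRECOMPUTED candidate lists (one list of `(Y_k, Z_k)` pairs per block). [folklore] -/
def existsCoverPre (YL ZL : List ℕ) : List (List (List ℕ × List ℕ)) → List ℕ → List ℕ → Bool
  | [], uY, uZ => (YL.all fun y => decide (y ∈ uY)) && (ZL.all fun t => decide (t ∈ uZ))
  | cands :: rest, uY, uZ =>
    cands.any fun YZ =>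
      (YZ.1.all fun y => !(decide (y ∈ uY))) && (YZ.2.all fun t => !(decide (t ∈ uZ))) && existsCoverPre YL ZL rest (YZ.1 ++ uY) (YZ.2 ++ uZ)

/-- `existsCoverPre` on the mapped candidate lists is `existsCoverZ`. [folklore] -/
theorem existsCoverPre_map_eq (p : ℕ) (YL ZL : List ℕ) :
    ∀ (blocks : List (ℕ × ℕ × ℕ)) (uY uZ : List ℕ),
      existsCoverPre YL ZL (blocks.map fun blk => blockDiffsZ p YL ZL blk.1 blk.2.1 blk.2.2) uY uZ = existsCoverZ p YL ZL blocks uY uZ := by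
  intro blocks
  induction blocks with
  | nil => intro uY uZ; rfl
  | cons blk rest ih =>
    intro uY uZ
    obtain ⟨a, b, c⟩ := blk
    rw [List.map_cons, existsCoverPre, existsCoverZ]
    congr 1
    funext YZ
    rw [ih]

end Summit.MatrixMultiplication.OmegaCensus.CubeNB
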